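import Summits.QuantumFields.YangMills.Theorems.BalabanUVNodesN06SectBStepUParKnitRecordN
import Literature.MathematicalPhysics.QuantumFieldTheory.Balaban1983to89.B9Thm39ReadingCoords
import Literature.MathematicalPhysics.QuantumFieldTheory.Balaban1983to89.B9GeoNbrCountKLevelV1
import Literature.MathematicalPhysics.QuantumFieldTheory.Balaban1983to89.B9Thm311PosDefQknitAtKnitLetterLawFreeY

/-!
# Balaban UV-stability nodes, N06 [B9] Sect. B — «K2-G-REC-B»: THE KNIT SECT.-B `hBK` SUPPLIER WITH ITS BASIS DATA, ITS IDLE THRESHOLDS AND ITS NEIGHBOUR COUNT READ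
# AT THE RECORD — of `sectBStepUPar_knitRecordKCN`'s 44 binders, the basis displays `M₂ hM₂ hrepr hcR hcL` are DISCHARGED for a GENERIC real basis `b` of `M_N(ℂ)`, the
# conclusion-free thresholds `MInv aW hMInv haW hMRI hMd hMr` are CHOSEN inside, and `mN hnbr` are READ from ONE record threshold `hM₀K` (the `hBK` fold's explicit arguments: 50 → 37)

[B9] = T. Bałaban, *Propagators for lattice gauge theories in a background field*, Commun. Math. Phys. **99** (1985) 389–434 [`Balaban1985BackgroundPropagators`];
[4] = T. Bałaban, *Propagators and renormalization transformations for lattice gauge theories. II*, Commun. Math. Phys. **96** (1984) 223–250 [`Balaban1984PropagatorsII`];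
[5] = T. Bałaban, *Averaging operations for lattice gauge theories*, Commun. Math. Phys. **98** (1985) 17–51 [`Balaban1985Averaging`].

statement-level skeleton of published theorems with citation tags; proofs where landed; nothing here is a claim about the Yang–Mills mass gap

THE PRINT.  Thm 3.4 p. 400 and Sect. B pp. 400–407 (the analytic extension in the background, read on `𝔤`-valued functions through real coordinates —
«functions with values in 𝔤», p. 392); [4] Lemma 2.1 (2.59)–(2.61) pp. 233–234 (the neighbourhood count of the multi-level geometry); (3.19) p. 393; [5] Prop. 2 p. 26.

WHY (seat `pub-ymgap-dag-n06-c` gen 28; cell `pub-ymgap`, HUMAN RULING D-0062, Track A node N06; CASCADE-K).  The knit certificate «KE₃X»∕«KE₄X» (dag-n06-d) folds its coded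
Sect.-B step `hBK` with `N06SectBStepUParKnitRecordN.sectBStepUPar_knitRecordKCN` (✓, gen 27) and therefore DISPLAYS that supplier's x-free inputs, among them (i) the
coordinate data of the coding basis `bR` — `M₂`, `hM₂ : 0 ≤ M₂`, `hrepr : |bR.repr v j| ≤ M₂‖v‖`, `hcR : 0 < M₂·Σ‖bR j‖`, `hcL : 0 < √|ι|·M₂·Σ‖bR j‖`; (ii) the member
threshold `MInv` of the guarded knit Thm 3.11 unit and the radius `aW` with `hMInv : 0 < MInv`, `haW : 0 < aW`, `hMRI : MR ≤ MInv`, `hMd : 2(d+1) < MInv`,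
`hMr : r_LB + 1 < MInv` — seven binders its CONCLUSION DOES NOT MENTION (the two-transporter step `SectBStepUPar …` carries its own thresholds); (iii) the neighbour
count `mN`, `hnbr : #nbr(geo9Y (f j)) (2(d+1)) y′ ≤ mN`.  Group (i) are THEOREMS for ANY real basis `b` of the finite-dimensional real space `M_N(ℂ)` (`N ≥ 1`): the
coordinate functional is bounded by `B9Thm39ReadingCoords.coordBound39 b` (`abs_repr_le`, landed) and `coordBound39 b`, `Σ_j ‖b j‖` are POSITIVE (a basis vector is
non-zero; the index type is inhabited) — §1; group (ii) is CHOSEN inside (`MInv := max MR 0 + |r_LB| + 2(d+1) + 2`, `aW := 1`); group (iii) is [4] Lemma 2.1's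
member-uniform `nbrCountY … (2(d+1))` above the ONE record threshold `nbrM₀Y … (2(d+1)) ≤ M⋆` (`B9GeoNbrCountKLevelV1.hnbr_of_le`, landed) — §2.  No basis is
pinned: the certificate's `bR` stays generic; no window numeric is touched (they share `α₀K ∕ aK ∕ ϱ′` with the other lanes and `aInv ∕ CqK ∕ MK` with the conclusion).

WHAT IS PROVED (sorry-free; 0 `def`).  §1 `coordBound39_pos`, `sum_norm_basis_pos`, ★ `coordBound39_mul_sum_norm_pos` (`hcR` at `M₂ := coordBound39 b`),
★ `sqrt_card_mul_coordBound39_mul_sum_norm_pos` (`hcL` likewise); §2 ★★★ `sectBStepUPar_knitRecordKCNB` = `sectBStepUPar_knitRecordKCN` applied at `M₂ := coordBound39 b`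
(`hM₂ ∕ hrepr ∕ hcR ∕ hcL` by §1 and `abs_repr_le`), `MInv := max MR 0 + |r_LB| + 2(d+1) + 2`, `aW := 1` (`hMInv haW hMRI hMd hMr` by `linarith`),
`mN := nbrCountY θ.d₆ θ.ℓ₆ θ.hd′ θ.hL′ θ.b₀ θ.b₁ (2((θ.d₆:ℝ)+1))`, `hnbr := hnbr_of_le hM₀K` — binder list = KCN's in KCN's order with
`M₂ hM₂ hrepr hcR hcL MInv aW hMInv haW hMRI hMd mN hnbr hMr` GONE (14) and ONE new x-free display `hM₀K` (in `hMd`'s place, before `h32`): the fold's explicit arguments go from 50 to 37.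
EDITION 2: §3 ★ `sectBStepUPar_knitRecordKCNBf` (row 17 displayed along `f` only: `hΔAKf`); §4 ★★★ `sectBStepUPar_knitRecordKCNBΔ` (row 17 discharged, no regime bridge; `∃ aΔ` form).

CONSUMER RECIPE («KE₅», dag-n06-d; optional).  `hBK := fun h32 h33 => …N06SectBStepUParKnitRecordNB.sectBStepUPar_knitRecordKCNB (instNE := fun x => B9Thm39ReadingCoords.bondIdx_nonempty _)
θ.toStage3Params Mstar f bR ιB C38 CqK MK aInv hι hCqK haInv c hP1 MR (q.a₁ ∕ c) hΔAK haIR hαK hαQK hα8 hα4N hαπN hKplK haIK hϱ' hϱ hsmall' hc₃' hϱ'1 hEc hdX hsmall hc₃ hM₀K h32 h33`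
— the certificate's displays `M₂ hM₂ hrepr hcR hcL MInv aW hMInv haW hMRI hMd mN hnbr hMr` DROPPED (if no other row reads them), `hM₀K : nbrM₀Y θ.d₆ θ.ℓ₆ θ.hd' θ.hL' θ.b₀ θ.b₁
(2 * ((θ.d₆ : ℝ) + 1)) ≤ Mstar` ADDED; or keep `…KCN` and pass the §1 terms `(coordBound39 bR) (coordBound39_pos bR).le (abs_repr_le bR) (coordBound39_mul_sum_norm_pos bR)
(sqrt_card_mul_coordBound39_mul_sum_norm_pos bR)` and `(nbrCountY …) (fun j y' => hnbr_of_le hM₀K (f j) y')` for groups (i)∕(iii) only.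

EDITION 2 (append-only; §1–§2 byte-identical).  The row-17 law `hΔAK` is the last LAW among the supplier's x-free inputs, and §2 reads it only at the family's own
members `f j`, each of which CARRIES A SECTION (`hι`), hence is section-carrying — where dag-n06-j's ✓ `B9Thm311PosDefQknitAtKnitLetterLawFreeY.
symm_posDefTr_deltaAQY_knitRecord_at_scMember` PROVES row 17 on print's class (3.35) above thresholds `M₁, a₁` (law-free; ✓ `B9KnitRows1517AlongSectionsY` is its
J-indexed reading).  §3 ★ `sectBStepUPar_knitRecordKCNBf` = §2 with `hΔAK` asked ALONG THE FAMILY only (`∀ j`, at `f j`; the shape a J-indexed certificate displays —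
⚑ LOCATED-3 of dag-n06-j); §4 ★★★ `sectBStepUPar_knitRecordKCNBΔ` = §2 with row 17 DISCHARGED by dag-n06-j's theorem and NO regime bridge (`c hP1 MR aR hΔAK haIR` gone;
the coded class of record projects onto print's class (3.35) by `⟨⟨hU.1.1, hU.1.2.2⟩, hU.2⟩`): the price is print's «α₀ sufficiently small» as an OPAQUE threshold —
the statement is `∃ aΔ > 0, ∀ aInv ∈ (0, aΔ], aInv ≤ aK → … → SectBStepUPar … (C37KY … MK aInv …) …`, the class constant `aInv` universally quantified under it.

HONEST SCOPE.  Instantiation ∕ bookkeeping of landed theorems (two lines of finite-dimensional linear algebra in §1, four `linarith` threshold checks in §2–§4); §2–§3 conditional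
on the displayed row-17 law, §4 on dag-n06-j's law-free Theorem 3.11 at section-carrying members; all on `h32`, `h33` and the window numerics exactly as `…KCN`; a HELPER by
key 27239 (KEY MAP v3) — NOT the discharge of any N06 obligation; count-neutral; nothing continuum ∕ OS ∕ mass gap ∕ Clay.  2026-08-31.
-/

noncomputable section

namespace Summit.QuantumFields.YangMills.BalabanUVNodes.N06SectBStepUParKnitRecordNB

open scoped Matrix Matrix.Norms.L2Operator
open Literature.MathematicalPhysics.QuantumFieldTheory.Balaban1983to89
open Literature.MathematicalPhysics.QuantumFieldTheory.Balaban1983to89.Node00 (SiteY BlkY FBondY IBondY CfgY SiteParY GAQY GpY XY deltaAQY deltaPrimeAY parSymY parBY)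
open Literature.MathematicalPhysics.QuantumFieldTheory.Balaban1983to89.Node00.OpsYQLetter (adjTrY)
open Literature.MathematicalPhysics.QuantumFieldTheory.Balaban1983to89.B6Ineq2142KLevelV1 (β)
open Literature.MathematicalPhysics.QuantumFieldTheory.Balaban1983to89.B6GlobalChartV1 (PV)
open Literature.MathematicalPhysics.QuantumFieldTheory.Balaban1983to89.B6KLevelCensusIndexV1 (KIdx kGeo)
open Literature.MathematicalPhysics.QuantumFieldTheory.Balaban1983to89.B6RandomWalk (HasMajorant Ineq261)
open Literature.MathematicalPhysics.QuantumFieldTheory.Balaban1983to89.B6RandomWalkL2 (HasL2Majorant)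
open Literature.MathematicalPhysics.QuantumFieldTheory.Balaban1983to89.B9Thm34Ext (toB6)
open Literature.MathematicalPhysics.QuantumFieldTheory.Balaban1983to89.B9PinMembersKLevelV1 (MemberY geo9Y)
open Literature.MathematicalPhysics.QuantumFieldTheory.Balaban1983to89.B9BackgroundsKLevelV1P (bg9KP)
open Literature.MathematicalPhysics.QuantumFieldTheory.Balaban1983to89.B9SectBCodedClassR (RegExtraY bg9YC extraYPb)
open Literature.MathematicalPhysics.QuantumFieldTheory.Balaban1983to89.B9Eq360DeltaPrimeAY (AfldY)
open Literature.MathematicalPhysics.QuantumFieldTheory.Balaban1983to89.B9SectBGpLettersY (GVal blkC)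
open Literature.MathematicalPhysics.QuantumFieldTheory.Balaban1983to89.B9SectBGpFrameCodedYR (codingYx)
open Literature.MathematicalPhysics.QuantumFieldTheory.Balaban1983to89.B9SectBCodedReadingsUR (KACU)
open Literature.MathematicalPhysics.QuantumFieldTheory.Balaban1983to89.B9SectBCodedReadingsUParH (KSCUPar SectBStepUPar)
open Literature.MathematicalPhysics.QuantumFieldTheory.Balaban1983to89.B9SectBKerFrameCodedYR (CinvY)
open Literature.MathematicalPhysics.QuantumFieldTheory.Balaban1983to89.B9RWSumsReadsNbr (nbr)
open Literature.MathematicalPhysics.QuantumFieldTheory.Balaban1983to89.B9Eq340TaxiContourLocalityY (rLB)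
open Literature.MathematicalPhysics.QuantumFieldTheory.Balaban1983to89.B9SectBCodedClassKnitY (C37KY regDatum_of_C37KY cplx337_of_C37KY le_of_C37KY)
open Literature.MathematicalPhysics.QuantumFieldTheory.Balaban1983to89.B9SectBQVarLawsOfKernelY (endBlock_small_of_cplx337)
open Literature.MathematicalPhysics.QuantumFieldTheory.Balaban1983to89.B7Prop2Explicit (unitaryUnits AvgClosed C0 c2')
open Literature.MathematicalPhysics.QuantumFieldTheory.Balaban1983to89.B7Prop3Flat (c3)
open Literature.MathematicalPhysics.QuantumFieldTheory.Balaban1983to89.B7Prop5CplxLevels (epsCplx tauCplx)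
open Literature.MathematicalPhysics.QuantumFieldTheory.Balaban1983to89.B5Eq118OneStroke (iterBlockOf)
open Literature.MathematicalPhysics.QuantumFieldTheory.Balaban1983to89.B9Eq316AveragingTransposeZd (alphaQ)
open Literature.MathematicalPhysics.QuantumFieldTheory.Balaban1983to89.B9Eq3115KnitLetterY (QknitY)
open Literature.MathematicalPhysics.QuantumFieldTheory.Balaban1983to89.B9C2FormBoxRegimeY (Kpl)
open Literature.MathematicalPhysics.QuantumFieldTheory.Balaban1983to89.B9B8KnitColumnFlatness (windows_of_alphaQ)
open Literature.MathematicalPhysics.QuantumFieldTheory.Balaban1983to89.B9B8AveragingJunction (parKnitY)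
open Summit.QuantumFields.YangMills.BalabanUVNodes.N06SectBQVarLawsKnit (hQ80_knit hQL280_knit)
open Summit.QuantumFields.YangMills.BalabanUVNodes.N06SectBStepUParKnit (sectBStepUPar_knit_of_laws)
open Literature.MathematicalPhysics.QuantumFieldTheory.Balaban1983to89.Node00 (SiteY BlkY FBondY IBondY CfgY SiteParY GAQY GpY XY deltaAQY deltaPrimeAY parSymY parBY
  kernelFamilyS kernelFamilyB Stage3Params)
open Literature.MathematicalPhysics.QuantumFieldTheory.Balaban1983to89.Node00.OpsYQLetter (adjTrY qKnitOfRecord qsKnitOfRecord)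
open Literature.MathematicalPhysics.QuantumFieldTheory.Balaban1983to89.Node00 (cqY)
open Literature.MathematicalPhysics.QuantumFieldTheory.Balaban1983to89.B9PinGeometryKLevelV1 (c35Y)
open Literature.MathematicalPhysics.QuantumFieldTheory.Balaban1983to89.B9PinGeometryKLevelV1B (c35Y_le_ten)
open Literature.MathematicalPhysics.QuantumFieldTheory.Balaban1983to89.B9SectBCodedClassKnitY (C37KY)
open Literature.MathematicalPhysics.QuantumFieldTheory.Balaban1983to89.B7Prop2Explicit (unitaryUnits c2')
open Literature.MathematicalPhysics.QuantumFieldTheory.Balaban1983to89.B7Prop2SpecialUnitary (specialUnitaryUnits specialUnitaryUnits_le_unitaryUnits)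
open Literature.MathematicalPhysics.QuantumFieldTheory.Balaban1983to89.B7AvgClosedSpecialUnitarySharp (avgClosed_specialUnitary_of_le)
open Literature.MathematicalPhysics.QuantumFieldTheory.Balaban1983to89.B9LeafXCodedKnitUParH (thm33Printed_codedUPar)
open Summit.QuantumFields.YangMills.BalabanUVNodes.N06SectBStepUParKnitFull (sectBStepUPar_knit)
open Literature.MathematicalPhysics.QuantumFieldTheory.Balaban1983to89.B9BackgroundsKLevelV1R (RegFamY bg9YR regYP335)
open Literature.MathematicalPhysics.QuantumFieldTheory.Balaban1983to89.B9LeafXClassAntitone (ClassIncl)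
open Literature.MathematicalPhysics.QuantumFieldTheory.Balaban1983to89.B9SectBCodedClassR (regC335 classIncl_regC335Pb_regYPb335)
open Literature.MathematicalPhysics.QuantumFieldTheory.Balaban1983to89.B9Thm311ReadingCoords (PosDefTr IsSymmTr isUnit_of_posDefTr)
open Literature.MathematicalPhysics.QuantumFieldTheory.Balaban1983to89.B7Prop2Explicit (C0)
open Summit.QuantumFields.YangMills.BalabanUVNodes.N06SectBStepUParKnitRecord (sectBStepUPar_knitRecord)
open Literature.MathematicalPhysics.QuantumFieldTheory.Balaban1983to89.B7Prop2SpecialUnitary (AvgClosedAt avgClosedAt_specialUnitary)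
open Summit.QuantumFields.YangMills.BalabanUVNodes.N06SectBStepUParKnitAt (sectBStepUPar_knit_of_lawsAt)
open Summit.QuantumFields.YangMills.BalabanUVNodes.N06SectBStepUParKnitFull (hC37R_of_C37KY hC37A_of_C37KY hC37ϱ_of_C37KY)

open Literature.MathematicalPhysics.QuantumFieldTheory.Balaban1983to89.B9Thm39ReadingCoords (coordBound39 abs_repr_le)
open Literature.MathematicalPhysics.QuantumFieldTheory.Balaban1983to89.B9GeoNbrCountKLevelV1 (nbrM₀Y nbrCountY hnbr_of_le)
open Summit.QuantumFields.YangMills.BalabanUVNodes.N06SectBStepUParKnitRecordN (sectBStepUPar_knitRecordKCN)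

/-! ## §1 The coordinate data of a generic real basis of `M_N(ℂ)`, `N ≥ 1` -/

section Basis

variable {N : ℕ} [Nonempty (Fin N)] {ι : Type} [Fintype ι] (b : Module.Basis ι ℝ (Matrix (Fin N) (Fin N) ℂ))

/-- The coordinate bound `coordBound39 b` of a real basis of `M_N(ℂ)` (`N ≥ 1`) is POSITIVE: `1 = |b.repr (b j₀) j₀| ≤ coordBound39 b · ‖b j₀‖` at any index `j₀`
(the index type of a basis of a non-trivial space is inhabited, a basis vector is non-zero). [cite: Balaban1985BackgroundPropagators, p.392 («functions with values in 𝔤», real coordinates), bookkeeping] -/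
theorem coordBound39_pos [FiniteDimensional ℝ (Matrix (Fin N) (Fin N) ℂ)] : 0 < coordBound39 b := by
  obtain ⟨j₀⟩ := b.index_nonempty
  have h1 : |b.repr (b j₀) j₀| ≤ coordBound39 b * ‖b j₀‖ := abs_repr_le b (b j₀) j₀
  rw [b.repr_self, Finsupp.single_eq_same, abs_one] at h1
  have hn : 0 < ‖b j₀‖ := norm_pos_iff.mpr (b.ne_zero j₀)
  by_contra h
  nlinarith [mul_nonpos_of_nonpos_of_nonneg (not_lt.mp h) hn.le]

/-- The basis vectors of a real basis of `M_N(ℂ)` (`N ≥ 1`) have POSITIVE total norm `Σ_j ‖b j‖`. [cite: Balaban1985BackgroundPropagators, p.392 («functions with values in 𝔤», real coordinates), bookkeeping] -/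
theorem sum_norm_basis_pos : 0 < ∑ j, ‖b j‖ := by
  haveI := b.index_nonempty
  exact Finset.sum_pos (fun j _ => norm_pos_iff.mpr (b.ne_zero j)) Finset.univ_nonempty

/-- ★ `hcR` OF THE CODED SECT.-B STEP AT `M₂ := coordBound39 b`: `0 < coordBound39 b · Σ_j ‖b j‖`. [cite: Balaban1985BackgroundPropagators, Thm 3.4 p.400, Sect. B pp.400–407 (the coded reading), bookkeeping] -/
theorem coordBound39_mul_sum_norm_pos [FiniteDimensional ℝ (Matrix (Fin N) (Fin N) ℂ)] : 0 < coordBound39 b * ∑ j, ‖b j‖ :=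
  mul_pos (coordBound39_pos b) (sum_norm_basis_pos b)

/-- ★ `hcL` OF THE CODED SECT.-B STEP AT `M₂ := coordBound39 b`: `0 < √|ι| · coordBound39 b · Σ_j ‖b j‖`. [cite: Balaban1985BackgroundPropagators, Thm 3.4 p.400, Sect. B pp.400–407 (the coded reading), bookkeeping] -/
theorem sqrt_card_mul_coordBound39_mul_sum_norm_pos [FiniteDimensional ℝ (Matrix (Fin N) (Fin N) ℂ)] :
    0 < Real.sqrt (Fintype.card ι) * coordBound39 b * ∑ j, ‖b j‖ := by
  haveI := b.index_nonempty
  have hc : 0 < Real.sqrt (Fintype.card ι) := Real.sqrt_pos.mpr (by exact_mod_cast Fintype.card_pos)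
  exact mul_pos (mul_pos hc (coordBound39_pos b)) (sum_norm_basis_pos b)

end Basis

/-! ## §2 The knit Sect.-B `hBK` supplier with the basis data, the idle thresholds and the neighbour count read at the record -/

section Record

variable {N : ℕ} [Nonempty (Fin N)] (θ : Stage3Params) (Mstar : ℕ)
variable {ι : Type} [Fintype ι] [DecidableEq ι]
variable {J : Type} (f : J → MemberY θ.d₆ θ.ℓ₆ θ.hd' θ.hL' θ.b₀ θ.b₁ Mstar)
  [∀ x : MemberY θ.d₆ θ.ℓ₆ θ.hd' θ.hL' θ.b₀ θ.b₁ Mstar, Fintype (geo9Y x).Site]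
  [instDS : ∀ x : MemberY θ.d₆ θ.ℓ₆ θ.hd' θ.hL' θ.b₀ θ.b₁ Mstar, DecidableEq (geo9Y x).Site]
  [instNE : ∀ x : MemberY θ.d₆ θ.ℓ₆ θ.hd' θ.hL' θ.b₀ θ.b₁ Mstar, Nonempty (geo9Y x).Site]
  (b : Module.Basis ι ℝ (Matrix (Fin N) (Fin N) ℂ)) (ιB : ∀ j : J, BlkY (f j).toKIdx → IBondY (f j).toKIdx)
  (C38 : ∀ j : J, ℝ → CfgY (Matrix (Fin N) (Fin N) ℂ) (f j).toKIdx → AfldY (Matrix (Fin N) (Fin N) ℂ) (f j).toKIdx → Prop)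
  (CqK MK aInv : ℝ)



/-- ★★★ **THE KNIT SECT.-B STEP OF RECORD IN THE CERTIFICATE's CURRENCY, BASIS DATA AND NEIGHBOUR COUNT READ AT THE RECORD** («K2-G-REC-B» edition of
`N06SectBStepUParKnitRecordN.sectBStepUPar_knitRecordKCN`): the same statement — `G := SU(N)` every `N`, the averaging pair of record, `P := extraYPb`, class token
`C37KY SU(N) (f j) (ιB j) ((bg9YC … extraYPb (f j)).Reg335 c35Y) (cqY d₆) CqK MK aInv (ϱ′·L³∕3)`, the guarded knit Thm 3.11 unit from the displayed row-17 law `hΔAK`, the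
α-windows `hα4N hαπN` — with the coding basis' five displays `M₂ hM₂ hrepr hcR hcL` DISCHARGED at `M₂ := coordBound39 b` for the GENERIC basis `b` (§1 and
`B9Thm39ReadingCoords.abs_repr_le`), the conclusion-free thresholds CHOSEN (`MInv := max MR 0 + |r_LB| + 2(d+1) + 2`, `aW := 1`; `hMInv haW hMRI hMd hMr` then hold), and
the neighbour count `mN hnbr` READ from the one record threshold `hM₀K : nbrM₀Y … (2(d+1)) ≤ M⋆` ([4] Lemma 2.1 (2.61): `mN := nbrCountY … (2(d+1))`,
`B9GeoNbrCountKLevelV1.hnbr_of_le`).  Binders = `…KCN`'s in the same order, fourteen gone, `hM₀K` new (before `h32`).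
[cite: Balaban1985BackgroundPropagators, Thm 3.4 p.400, Sect. B pp.400–407, Thm 3.11 p.416, (3.24)–(3.25) p.394, (3.19) p.393, (3.35)–(3.37) p.396, Thms 3.2–3.3 pp.398–399; Balaban1984PropagatorsII, Lemma 2.1 (2.59)–(2.61) pp.233–234; Balaban1985Averaging, Prop. 2 p.26, Prop. 7 p.43] -/
theorem sectBStepUPar_knitRecordKCNB [NormOneClass (Matrix (Fin N) (Fin N) ℂ)] [FiniteDimensional ℝ (Matrix (Fin N) (Fin N) ℂ)]
    (hι : ∀ (j : J) (s : BlkY (f j).toKIdx), β (f j).toKIdx.hN (f j).toKIdx.D (f j).toKIdx.hk (ιB j s) = s)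
    (hCqK : 0 ≤ CqK) (haInv : 0 < aInv)
    {R₁ R₂ : RegFamY θ.d₆ θ.ℓ₆ θ.hd' θ.hL' θ.b₀ θ.b₁ Mstar (Matrix (Fin N) (Fin N) ℂ)} (c : ℝ)
    (hP1 : ClassIncl (regYP335 (Matrix (Fin N) (Fin N) ℂ) (specialUnitaryUnits (Fin N))) c35Y R₁ c) (MR aR : ℝ)
    (hΔAK : ∀ x : MemberY θ.d₆ θ.ℓ₆ θ.hd' θ.hL' θ.b₀ θ.b₁ Mstar, MR ≤ (geo9Y x).M → ∀ α₀ : ℝ, 0 < α₀ → (geo9Y x).M * α₀ ≤ aR →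
      ∀ U : (bg9YR (Matrix (Fin N) (Fin N) ℂ) (specialUnitaryUnits (Fin N)) R₁ R₂ x).Cfg, (bg9YR (Matrix (Fin N) (Fin N) ℂ) (specialUnitaryUnits (Fin N)) R₁ R₂ x).Reg335 c α₀ U →
        IsSymmTr (fun _ => (1 : ℝ)) (deltaAQY x.toKIdx (qKnitOfRecord N θ x.toKIdx) (qsKnitOfRecord N θ x.toKIdx) (parKnitY x.toKIdx) (GpY x.toKIdx (parKnitY x.toKIdx)) U) ∧
          PosDefTr (fun _ => (1 : ℝ)) (deltaAQY x.toKIdx (qKnitOfRecord N θ x.toKIdx) (qsKnitOfRecord N θ x.toKIdx) (parKnitY x.toKIdx) (GpY x.toKIdx (parKnitY x.toKIdx)) U))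
    (haIR : aInv ≤ aR)
    {α₀K aK : ℝ} (hαK : 0 < α₀K) (hαQ : α₀K ≤ alphaQ (θ.d₆ + 1) (θ.ℓ₆ + 1)) (hα8 : 8 * α₀K ≤ c2' (θ.d₆ + 1) (θ.ℓ₆ + 1))
    (hα4N : 32 * (((θ.d₆ + 1 : ℕ) : ℝ) + 1) * ((θ.d₆ + 1 : ℕ) + 4) * (((θ.ℓ₆ + 1 : ℕ) : ℝ)) ^ 2 * α₀K ≤ 1 / 4) (hαπN : (N : ℝ) * (32 * (((θ.d₆ + 1 : ℕ) : ℝ) + 1) * ((θ.d₆ + 1 : ℕ) + 4) * (((θ.ℓ₆ + 1 : ℕ) : ℝ)) ^ 2 * α₀K) < Real.pi)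
    (hKplK : ∀ (i : KIdx θ.d₆ θ.ℓ₆ θ.hd' θ.hL' θ.b₀ θ.b₁) (a : ℝ), 0 ≤ a → a ≤ aK → Kpl i a * (kGeo i).L ^ 4 < α₀K) (haIK : aInv ≤ aK)
    {ϱ' ϱ : ℝ} (hϱ' : 0 < ϱ') (hϱ : 0 < ϱ)
    (hsmall' : Real.exp (4 * (800 * (((θ.d₆ + 1 : ℕ) : ℝ) + 1) ^ 2 * (((θ.d₆ + 1 : ℕ) : ℝ) + 4)) * α₀K)
      * (1 + 8 * (131072 * (((θ.d₆ + 1 : ℕ) : ℝ) + 1) ^ 2) * ϱ') ≤ 2)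
    (hc₃' : 2 * ϱ' ≤ c3 (θ.d₆ + 1) (θ.ℓ₆ + 1)) (hϱ'1 : 409600 * (((θ.d₆ + 1 : ℕ) : ℝ) + 1) ^ 2 * ϱ' ≤ 1)
    (hE : epsCplx (θ.d₆ + 1) (θ.ℓ₆ + 1) ϱ' 0 ≤ 1 / 16)
    (hdX : ((θ.d₆ + 1 : ℕ) : ℝ) * (epsCplx (θ.d₆ + 1) (θ.ℓ₆ + 1) ϱ' 0 + tauCplx (θ.d₆ + 1) (θ.ℓ₆ + 1) α₀K 0 ϱ' 0) ≤ 1 / 16)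
    (hsmall : Real.exp (4480 * (((θ.d₆ + 1 : ℕ) : ℝ) + 1) ^ 2 * (((θ.d₆ + 1 : ℕ) : ℝ) + 4) * α₀K + 240000 * (((θ.d₆ + 1 : ℕ) : ℝ) + 1) ^ 3 * ϱ')
      * (1 + 8 * (2097152 * (((θ.d₆ + 1 : ℕ) : ℝ) + 1) ^ 2) * ϱ) ≤ 2)
    (hc₃ : 2 * ϱ ≤ c3 (θ.d₆ + 1) (θ.ℓ₆ + 1) / 4)
    (hM₀K : nbrM₀Y θ.d₆ θ.ℓ₆ θ.hd' θ.hL' θ.b₀ θ.b₁ (2 * ((θ.d₆ : ℝ) + 1)) ≤ Mstar)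
    (h32 : B9.Thm32Printed (θ.d₆ + 1) c35Y (fun j => geo9Y (f j))
      (fun j => bg9YC (Matrix (Fin N) (Fin N) ℂ) (specialUnitaryUnits (Fin N)) (extraYPb (Matrix (Fin N) (Fin N) ℂ) (specialUnitaryUnits (Fin N))) (f j))
      (CinvY (extraYPb (Matrix (Fin N) (Fin N) ℂ) (specialUnitaryUnits (Fin N))) f (specialUnitaryUnits (Fin N)) (fun j => parKnitY (f j).toKIdx)))
    (h33 : B9.Thm33Printed c35Y (fun j => geo9Y (f j))
      (fun j => bg9YC (Matrix (Fin N) (Fin N) ℂ) (specialUnitaryUnits (Fin N)) (extraYPb (Matrix (Fin N) (Fin N) ℂ) (specialUnitaryUnits (Fin N))) (f j))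
      (fun j => kernelFamilyS (f j).toKIdx
        (bg9YC (Matrix (Fin N) (Fin N) ℂ) (specialUnitaryUnits (Fin N)) (extraYPb (Matrix (Fin N) (Fin N) ℂ) (specialUnitaryUnits (Fin N))) (f j)) (fun U => U)
        (GpY (f j).toKIdx (parKnitY (f j).toKIdx)) (parSymY (f j).toKIdx))
      (fun j => kernelFamilyB (f j).toKIdx
        (bg9YC (Matrix (Fin N) (Fin N) ℂ) (specialUnitaryUnits (Fin N)) (extraYPb (Matrix (Fin N) (Fin N) ℂ) (specialUnitaryUnits (Fin N))) (f j)) (fun U => U)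
        (GAQY (f j).toKIdx (qKnitOfRecord N θ (f j).toKIdx) (qsKnitOfRecord N θ (f j).toKIdx) (parKnitY (f j).toKIdx) (GpY (f j).toKIdx (parKnitY (f j).toKIdx)))
        (parBY (f j).toKIdx))) :
    SectBStepUPar (extraYPb (Matrix (Fin N) (Fin N) ℂ) (specialUnitaryUnits (Fin N))) f (θ.d₆ + 1) c35Y (specialUnitaryUnits (Fin N)) b
      (fun j => parKnitY (f j).toKIdx) (fun j => parSymY (f j).toKIdx)
      (fun j => GAQY (f j).toKIdx (qKnitOfRecord N θ (f j).toKIdx) (qsKnitOfRecord N θ (f j).toKIdx) (parKnitY (f j).toKIdx) (GpY (f j).toKIdx (parKnitY (f j).toKIdx)))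
      (fun j => parBY (f j).toKIdx)
      (fun j => C37KY (specialUnitaryUnits (Fin N)) (f j) (ιB j)
        (fun α₀ U => (bg9YC (Matrix (Fin N) (Fin N) ℂ) (specialUnitaryUnits (Fin N)) (extraYPb (Matrix (Fin N) (Fin N) ℂ) (specialUnitaryUnits (Fin N))) (f j)).Reg335 c35Y α₀ U)
        (cqY θ.d₆) CqK MK aInv (ϱ' * (((θ.ℓ₆ + 1 : ℕ) : ℝ)) ^ 3 / 3))
      C38 (CinvY (extraYPb (Matrix (Fin N) (Fin N) ℂ) (specialUnitaryUnits (Fin N))) f (specialUnitaryUnits (Fin N)) (fun j => parKnitY (f j).toKIdx)) := by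
  -- the two thresholds of `…KCN` that its conclusion does not mention are CHOSEN here: the member threshold `MInv` of the guarded knit Thm 3.11 unit (above the
  -- row-17 threshold `MR`, the averaging reach `2(d+1)` and the taxi-contour radius `r_LB + 1`) and the idle radius `aW := 1`
  have hmax : MR ≤ max MR 0 := le_max_left MR 0
  have hmax0 : 0 ≤ max MR 0 := le_max_right MR 0
  have habs : rLB θ.d₆ θ.ℓ₆ ≤ |rLB θ.d₆ θ.ℓ₆| := le_abs_self _
  have habs0 : 0 ≤ |rLB θ.d₆ θ.ℓ₆| := abs_nonneg _
  have hd0 : (0 : ℝ) ≤ 2 * ((θ.d₆ : ℝ) + 1) := by positivity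
  exact sectBStepUPar_knitRecordKCN θ Mstar f b ιB C38 CqK MK aInv hι (coordBound39 b) (coordBound39_pos b).le (abs_repr_le b)
    (coordBound39_mul_sum_norm_pos b) (sqrt_card_mul_coordBound39_mul_sum_norm_pos b) hCqK
    (max MR 0 + |rLB θ.d₆ θ.ℓ₆| + 2 * ((θ.d₆ : ℝ) + 1) + 2) 1 (by linarith) haInv one_pos c hP1 MR aR hΔAK (by linarith) haIR hαK hαQ hα8
    hα4N hαπN hKplK haIK hϱ' hϱ hsmall' hc₃' hϱ'1 hE hdX hsmall hc₃ (by linarith) (nbrCountY θ.d₆ θ.ℓ₆ θ.hd' θ.hL' θ.b₀ θ.b₁ (2 * ((θ.d₆ : ℝ) + 1)))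
    (fun j y' => hnbr_of_le hM₀K (f j) y') (by linarith) h32 h33

/-! ## §3–§4 (EDITION 2) The row-17 law along the family only, and discharged -/

open Summit.QuantumFields.YangMills.BalabanUVNodes.N06SectBStepUParKnitRecordN (sectBStepUPar_knitRecordN)
open Literature.MathematicalPhysics.QuantumFieldTheory.Balaban1983to89.B9Thm311PosDefQknitAtKnitLetterLawFreeY (symm_posDefTr_deltaAQY_knitRecord_at_scMember)

/-- ★ **EDITION 2, §3 — THE SAME SUPPLIER WITH THE ROW-17 LAW ASKED ALONG THE FAMILY ONLY** (`hΔAKf : ∀ j, …` at `f j`, thresholds `MR ∕ aR` displayed): §2 reads `hΔAK`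
at the members `f j` only, so the J-indexed display suffices verbatim — this is the shape a certificate quantifying its sub-family `(f, ιB, hι)` carries (dag-n06-j
`B9KnitRows1517AlongSectionsY.symm_posDefTr_deltaAQY_knitRecord_along_sections` inhabits it law-free above its thresholds).  Proof = §2's with `hΔAK (f j)` ↦ `hΔAKf j`.
[cite: Balaban1985BackgroundPropagators, Thm 3.4 p.400, Sect. B pp.400–407, Thm 3.11 p.416, (3.19) p.393, (3.35)–(3.37) p.396, Thms 3.2–3.3 pp.398–399; Balaban1984PropagatorsII, Lemma 2.1 (2.59)–(2.61) pp.233–234; Balaban1985Averaging, Prop. 2 p.26, Prop. 7 p.43] -/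
theorem sectBStepUPar_knitRecordKCNBf [NormOneClass (Matrix (Fin N) (Fin N) ℂ)] [FiniteDimensional ℝ (Matrix (Fin N) (Fin N) ℂ)]
    (hι : ∀ (j : J) (s : BlkY (f j).toKIdx), β (f j).toKIdx.hN (f j).toKIdx.D (f j).toKIdx.hk (ιB j s) = s)
    (hCqK : 0 ≤ CqK) (haInv : 0 < aInv)
    {R₁ R₂ : RegFamY θ.d₆ θ.ℓ₆ θ.hd' θ.hL' θ.b₀ θ.b₁ Mstar (Matrix (Fin N) (Fin N) ℂ)} (c : ℝ)
    (hP1 : ClassIncl (regYP335 (Matrix (Fin N) (Fin N) ℂ) (specialUnitaryUnits (Fin N))) c35Y R₁ c) (MR aR : ℝ)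
    (hΔAKf : ∀ j : J, MR ≤ (geo9Y (f j)).M → ∀ α₀ : ℝ, 0 < α₀ → (geo9Y (f j)).M * α₀ ≤ aR →
      ∀ U : (bg9YR (Matrix (Fin N) (Fin N) ℂ) (specialUnitaryUnits (Fin N)) R₁ R₂ (f j)).Cfg,
        (bg9YR (Matrix (Fin N) (Fin N) ℂ) (specialUnitaryUnits (Fin N)) R₁ R₂ (f j)).Reg335 c α₀ U →
        IsSymmTr (fun _ => (1 : ℝ)) (deltaAQY (f j).toKIdx (qKnitOfRecord N θ (f j).toKIdx) (qsKnitOfRecord N θ (f j).toKIdx) (parKnitY (f j).toKIdx)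
            (GpY (f j).toKIdx (parKnitY (f j).toKIdx)) U) ∧
          PosDefTr (fun _ => (1 : ℝ)) (deltaAQY (f j).toKIdx (qKnitOfRecord N θ (f j).toKIdx) (qsKnitOfRecord N θ (f j).toKIdx) (parKnitY (f j).toKIdx)
            (GpY (f j).toKIdx (parKnitY (f j).toKIdx)) U))
    (haIR : aInv ≤ aR)
    {α₀K aK : ℝ} (hαK : 0 < α₀K) (hαQ : α₀K ≤ alphaQ (θ.d₆ + 1) (θ.ℓ₆ + 1)) (hα8 : 8 * α₀K ≤ c2' (θ.d₆ + 1) (θ.ℓ₆ + 1))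
    (hα4N : 32 * (((θ.d₆ + 1 : ℕ) : ℝ) + 1) * ((θ.d₆ + 1 : ℕ) + 4) * (((θ.ℓ₆ + 1 : ℕ) : ℝ)) ^ 2 * α₀K ≤ 1 / 4) (hαπN : (N : ℝ) * (32 * (((θ.d₆ + 1 : ℕ) : ℝ) + 1) * ((θ.d₆ + 1 : ℕ) + 4) * (((θ.ℓ₆ + 1 : ℕ) : ℝ)) ^ 2 * α₀K) < Real.pi)
    (hKplK : ∀ (i : KIdx θ.d₆ θ.ℓ₆ θ.hd' θ.hL' θ.b₀ θ.b₁) (a : ℝ), 0 ≤ a → a ≤ aK → Kpl i a * (kGeo i).L ^ 4 < α₀K) (haIK : aInv ≤ aK)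
    {ϱ' ϱ : ℝ} (hϱ' : 0 < ϱ') (hϱ : 0 < ϱ)
    (hsmall' : Real.exp (4 * (800 * (((θ.d₆ + 1 : ℕ) : ℝ) + 1) ^ 2 * (((θ.d₆ + 1 : ℕ) : ℝ) + 4)) * α₀K)
      * (1 + 8 * (131072 * (((θ.d₆ + 1 : ℕ) : ℝ) + 1) ^ 2) * ϱ') ≤ 2)
    (hc₃' : 2 * ϱ' ≤ c3 (θ.d₆ + 1) (θ.ℓ₆ + 1)) (hϱ'1 : 409600 * (((θ.d₆ + 1 : ℕ) : ℝ) + 1) ^ 2 * ϱ' ≤ 1)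
    (hE : epsCplx (θ.d₆ + 1) (θ.ℓ₆ + 1) ϱ' 0 ≤ 1 / 16)
    (hdX : ((θ.d₆ + 1 : ℕ) : ℝ) * (epsCplx (θ.d₆ + 1) (θ.ℓ₆ + 1) ϱ' 0 + tauCplx (θ.d₆ + 1) (θ.ℓ₆ + 1) α₀K 0 ϱ' 0) ≤ 1 / 16)
    (hsmall : Real.exp (4480 * (((θ.d₆ + 1 : ℕ) : ℝ) + 1) ^ 2 * (((θ.d₆ + 1 : ℕ) : ℝ) + 4) * α₀K + 240000 * (((θ.d₆ + 1 : ℕ) : ℝ) + 1) ^ 3 * ϱ')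
      * (1 + 8 * (2097152 * (((θ.d₆ + 1 : ℕ) : ℝ) + 1) ^ 2) * ϱ) ≤ 2)
    (hc₃ : 2 * ϱ ≤ c3 (θ.d₆ + 1) (θ.ℓ₆ + 1) / 4)
    (hM₀K : nbrM₀Y θ.d₆ θ.ℓ₆ θ.hd' θ.hL' θ.b₀ θ.b₁ (2 * ((θ.d₆ : ℝ) + 1)) ≤ Mstar)
    (h32 : B9.Thm32Printed (θ.d₆ + 1) c35Y (fun j => geo9Y (f j))
      (fun j => bg9YC (Matrix (Fin N) (Fin N) ℂ) (specialUnitaryUnits (Fin N)) (extraYPb (Matrix (Fin N) (Fin N) ℂ) (specialUnitaryUnits (Fin N))) (f j))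
      (CinvY (extraYPb (Matrix (Fin N) (Fin N) ℂ) (specialUnitaryUnits (Fin N))) f (specialUnitaryUnits (Fin N)) (fun j => parKnitY (f j).toKIdx)))
    (h33 : B9.Thm33Printed c35Y (fun j => geo9Y (f j))
      (fun j => bg9YC (Matrix (Fin N) (Fin N) ℂ) (specialUnitaryUnits (Fin N)) (extraYPb (Matrix (Fin N) (Fin N) ℂ) (specialUnitaryUnits (Fin N))) (f j))
      (fun j => kernelFamilyS (f j).toKIdx
        (bg9YC (Matrix (Fin N) (Fin N) ℂ) (specialUnitaryUnits (Fin N)) (extraYPb (Matrix (Fin N) (Fin N) ℂ) (specialUnitaryUnits (Fin N))) (f j)) (fun U => U)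
        (GpY (f j).toKIdx (parKnitY (f j).toKIdx)) (parSymY (f j).toKIdx))
      (fun j => kernelFamilyB (f j).toKIdx
        (bg9YC (Matrix (Fin N) (Fin N) ℂ) (specialUnitaryUnits (Fin N)) (extraYPb (Matrix (Fin N) (Fin N) ℂ) (specialUnitaryUnits (Fin N))) (f j)) (fun U => U)
        (GAQY (f j).toKIdx (qKnitOfRecord N θ (f j).toKIdx) (qsKnitOfRecord N θ (f j).toKIdx) (parKnitY (f j).toKIdx) (GpY (f j).toKIdx (parKnitY (f j).toKIdx)))
        (parBY (f j).toKIdx))) :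
    SectBStepUPar (extraYPb (Matrix (Fin N) (Fin N) ℂ) (specialUnitaryUnits (Fin N))) f (θ.d₆ + 1) c35Y (specialUnitaryUnits (Fin N)) b
      (fun j => parKnitY (f j).toKIdx) (fun j => parSymY (f j).toKIdx)
      (fun j => GAQY (f j).toKIdx (qKnitOfRecord N θ (f j).toKIdx) (qsKnitOfRecord N θ (f j).toKIdx) (parKnitY (f j).toKIdx) (GpY (f j).toKIdx (parKnitY (f j).toKIdx)))
      (fun j => parBY (f j).toKIdx)
      (fun j => C37KY (specialUnitaryUnits (Fin N)) (f j) (ιB j)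
        (fun α₀ U => (bg9YC (Matrix (Fin N) (Fin N) ℂ) (specialUnitaryUnits (Fin N)) (extraYPb (Matrix (Fin N) (Fin N) ℂ) (specialUnitaryUnits (Fin N))) (f j)).Reg335 c35Y α₀ U)
        (cqY θ.d₆) CqK MK aInv (ϱ' * (((θ.ℓ₆ + 1 : ℕ) : ℝ)) ^ 3 / 3))
      C38 (CinvY (extraYPb (Matrix (Fin N) (Fin N) ℂ) (specialUnitaryUnits (Fin N))) f (specialUnitaryUnits (Fin N)) (fun j => parKnitY (f j).toKIdx)) := by
  -- «KC»'s bridge: the coded class of record at `c35Y` lies in the certificate's class `R₁` at `c` (for `0 < α₀`)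
  have h1U : ClassIncl (regC335 (Matrix (Fin N) (Fin N) ℂ) (specialUnitaryUnits (Fin N)) (extraYPb (Matrix (Fin N) (Fin N) ℂ) (specialUnitaryUnits (Fin N)))) c35Y R₁ c :=
    fun x α₀ U hα h => hP1 x α₀ U hα (classIncl_regC335Pb_regYPb335 c35Y c35Y x α₀ U hα h).2
  have habs : rLB θ.d₆ θ.ℓ₆ ≤ |rLB θ.d₆ θ.ℓ₆| := le_abs_self _
  have habs0 : 0 ≤ |rLB θ.d₆ θ.ℓ₆| := abs_nonneg _
  have hmax : MR ≤ max MR 0 := le_max_left MR 0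
  have hmax0 : 0 ≤ max MR 0 := le_max_right MR 0
  have hd0 : (0 : ℝ) ≤ 2 * ((θ.d₆ : ℝ) + 1) := by positivity
  -- the guarded knit Thm 3.11 unit at the family's members, from the J-indexed row 17: «positive, hence invertible»
  have hunitA : ∀ j (α₀ : ℝ) (U : CfgY (Matrix (Fin N) (Fin N) ℂ) (f j).toKIdx), max MR 0 + |rLB θ.d₆ θ.ℓ₆| + 2 * ((θ.d₆ : ℝ) + 1) + 2 ≤ (geo9Y (f j)).M →
      0 < α₀ → (geo9Y (f j)).M * α₀ ≤ aInv →
      (bg9YC (Matrix (Fin N) (Fin N) ℂ) (specialUnitaryUnits (Fin N)) (extraYPb (Matrix (Fin N) (Fin N) ℂ) (specialUnitaryUnits (Fin N))) (f j)).Reg335 c35Y α₀ U →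
      IsUnit (deltaAQY (f j).toKIdx (qKnitOfRecord N θ (f j).toKIdx) (qsKnitOfRecord N θ (f j).toKIdx) (parKnitY (f j).toKIdx)
        (GpY (f j).toKIdx (parKnitY (f j).toKIdx)) U) :=
    fun j α₀ U hM hα ha hU => isUnit_of_posDefTr (hΔAKf j (by linarith) α₀ hα (ha.trans haIR) U (h1U (f j) α₀ U hα hU)).2
  exact sectBStepUPar_knitRecordN θ Mstar f b ιB C38 CqK MK aInv hι (coordBound39 b) (coordBound39_pos b).le (abs_repr_le b)
    (coordBound39_mul_sum_norm_pos b) (sqrt_card_mul_coordBound39_mul_sum_norm_pos b) hCqK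
    (max MR 0 + |rLB θ.d₆ θ.ℓ₆| + 2 * ((θ.d₆ : ℝ) + 1) + 2) 1 (by linarith) haInv one_pos hαK hαQ hα8 hα4N hαπN
    (fun j a h0 ha => hKplK (f j).toKIdx a h0 (ha.trans haIK)) hϱ' hϱ hsmall' hc₃' hϱ'1 hE hdX hsmall hc₃ hunitA (by linarith)
    (nbrCountY θ.d₆ θ.ℓ₆ θ.hd' θ.hL' θ.b₀ θ.b₁ (2 * ((θ.d₆ : ℝ) + 1))) (fun j y' => hnbr_of_le hM₀K (f j) y') (by linarith) h32 h33

/-- ★★★ **EDITION 2, §4 — THE KNIT SECT.-B `hBK` SUPPLIER WITH ROW 17 DISCHARGED AND NO REGIME BRIDGE** (law-free in its x-free inputs): every member `f j` of the family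
carries the section `ιB j` (`hι`), so `β` is onto at `f j` and dag-n06-j's `B9Thm311PosDefQknitAtKnitLetterLawFreeY.symm_posDefTr_deltaAQY_knitRecord_at_scMember` gives
Theorem 3.11's «symmetric, positive — hence invertible» for `Δ_a^𝔮(U)` at the knit pair of record on print's class (3.35) above thresholds `M₁, a₁`; the coded class of
record PROJECTS onto print's class (`⟨⟨hU.1.1, hU.1.2.2⟩, hU.2⟩`), so no `R₁ ∕ c ∕ hP1` is needed.  The thresholds are print's «M sufficiently large, α₀ sufficiently small»:
the member threshold is absorbed by the Sect.-B step's own `∃ M₀`, the smallness becomes the OPAQUE `aΔ := a₁` under which the class constant `aInv` ranges —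
statement `∃ aΔ > 0, ∀ aInv, 0 < aInv → aInv ≤ aΔ → aInv ≤ aK → Thm 3.2 → Thm 3.3 → SectBStepUPar … (C37KY … MK aInv …) …`; the other binders are §2's (data `hι hCqK`,
the window numerics, `hM₀K`). [cite: Balaban1985BackgroundPropagators, Thm 3.4 p.400, Sect. B pp.400–407, Thm 3.11 p.416 («for M sufficiently large and α₀ sufficiently small»), (3.19) p.393, (3.35)–(3.37) p.396, Thms 3.2–3.3 pp.398–399; Balaban1984PropagatorsII, Lemma 2.1 (2.59)–(2.61) pp.233–234, (2.3) p.224; Balaban1985Averaging, Prop. 2 p.26, Prop. 7 p.43] -/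
theorem sectBStepUPar_knitRecordKCNBΔ [NormOneClass (Matrix (Fin N) (Fin N) ℂ)] [FiniteDimensional ℝ (Matrix (Fin N) (Fin N) ℂ)]
    (hι : ∀ (j : J) (s : BlkY (f j).toKIdx), β (f j).toKIdx.hN (f j).toKIdx.D (f j).toKIdx.hk (ιB j s) = s)
    (hCqK : 0 ≤ CqK)
    {α₀K aK : ℝ} (hαK : 0 < α₀K) (hαQ : α₀K ≤ alphaQ (θ.d₆ + 1) (θ.ℓ₆ + 1)) (hα8 : 8 * α₀K ≤ c2' (θ.d₆ + 1) (θ.ℓ₆ + 1))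
    (hα4N : 32 * (((θ.d₆ + 1 : ℕ) : ℝ) + 1) * ((θ.d₆ + 1 : ℕ) + 4) * (((θ.ℓ₆ + 1 : ℕ) : ℝ)) ^ 2 * α₀K ≤ 1 / 4) (hαπN : (N : ℝ) * (32 * (((θ.d₆ + 1 : ℕ) : ℝ) + 1) * ((θ.d₆ + 1 : ℕ) + 4) * (((θ.ℓ₆ + 1 : ℕ) : ℝ)) ^ 2 * α₀K) < Real.pi)
    (hKplK : ∀ (i : KIdx θ.d₆ θ.ℓ₆ θ.hd' θ.hL' θ.b₀ θ.b₁) (a : ℝ), 0 ≤ a → a ≤ aK → Kpl i a * (kGeo i).L ^ 4 < α₀K)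
    {ϱ' ϱ : ℝ} (hϱ' : 0 < ϱ') (hϱ : 0 < ϱ)
    (hsmall' : Real.exp (4 * (800 * (((θ.d₆ + 1 : ℕ) : ℝ) + 1) ^ 2 * (((θ.d₆ + 1 : ℕ) : ℝ) + 4)) * α₀K)
      * (1 + 8 * (131072 * (((θ.d₆ + 1 : ℕ) : ℝ) + 1) ^ 2) * ϱ') ≤ 2)
    (hc₃' : 2 * ϱ' ≤ c3 (θ.d₆ + 1) (θ.ℓ₆ + 1)) (hϱ'1 : 409600 * (((θ.d₆ + 1 : ℕ) : ℝ) + 1) ^ 2 * ϱ' ≤ 1)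
    (hE : epsCplx (θ.d₆ + 1) (θ.ℓ₆ + 1) ϱ' 0 ≤ 1 / 16)
    (hdX : ((θ.d₆ + 1 : ℕ) : ℝ) * (epsCplx (θ.d₆ + 1) (θ.ℓ₆ + 1) ϱ' 0 + tauCplx (θ.d₆ + 1) (θ.ℓ₆ + 1) α₀K 0 ϱ' 0) ≤ 1 / 16)
    (hsmall : Real.exp (4480 * (((θ.d₆ + 1 : ℕ) : ℝ) + 1) ^ 2 * (((θ.d₆ + 1 : ℕ) : ℝ) + 4) * α₀K + 240000 * (((θ.d₆ + 1 : ℕ) : ℝ) + 1) ^ 3 * ϱ')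
      * (1 + 8 * (2097152 * (((θ.d₆ + 1 : ℕ) : ℝ) + 1) ^ 2) * ϱ) ≤ 2)
    (hc₃ : 2 * ϱ ≤ c3 (θ.d₆ + 1) (θ.ℓ₆ + 1) / 4)
    (hM₀K : nbrM₀Y θ.d₆ θ.ℓ₆ θ.hd' θ.hL' θ.b₀ θ.b₁ (2 * ((θ.d₆ : ℝ) + 1)) ≤ Mstar) :
    ∃ aΔ : ℝ, 0 < aΔ ∧ ∀ aInv : ℝ, 0 < aInv → aInv ≤ aΔ → aInv ≤ aK →
      B9.Thm32Printed (θ.d₆ + 1) c35Y (fun j => geo9Y (f j))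
      (fun j => bg9YC (Matrix (Fin N) (Fin N) ℂ) (specialUnitaryUnits (Fin N)) (extraYPb (Matrix (Fin N) (Fin N) ℂ) (specialUnitaryUnits (Fin N))) (f j))
      (CinvY (extraYPb (Matrix (Fin N) (Fin N) ℂ) (specialUnitaryUnits (Fin N))) f (specialUnitaryUnits (Fin N)) (fun j => parKnitY (f j).toKIdx)) →
      B9.Thm33Printed c35Y (fun j => geo9Y (f j))
      (fun j => bg9YC (Matrix (Fin N) (Fin N) ℂ) (specialUnitaryUnits (Fin N)) (extraYPb (Matrix (Fin N) (Fin N) ℂ) (specialUnitaryUnits (Fin N))) (f j))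
      (fun j => kernelFamilyS (f j).toKIdx
        (bg9YC (Matrix (Fin N) (Fin N) ℂ) (specialUnitaryUnits (Fin N)) (extraYPb (Matrix (Fin N) (Fin N) ℂ) (specialUnitaryUnits (Fin N))) (f j)) (fun U => U)
        (GpY (f j).toKIdx (parKnitY (f j).toKIdx)) (parSymY (f j).toKIdx))
      (fun j => kernelFamilyB (f j).toKIdx
        (bg9YC (Matrix (Fin N) (Fin N) ℂ) (specialUnitaryUnits (Fin N)) (extraYPb (Matrix (Fin N) (Fin N) ℂ) (specialUnitaryUnits (Fin N))) (f j)) (fun U => U)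
        (GAQY (f j).toKIdx (qKnitOfRecord N θ (f j).toKIdx) (qsKnitOfRecord N θ (f j).toKIdx) (parKnitY (f j).toKIdx) (GpY (f j).toKIdx (parKnitY (f j).toKIdx)))
        (parBY (f j).toKIdx)) →
  SectBStepUPar (extraYPb (Matrix (Fin N) (Fin N) ℂ) (specialUnitaryUnits (Fin N))) f (θ.d₆ + 1) c35Y (specialUnitaryUnits (Fin N)) b
      (fun j => parKnitY (f j).toKIdx) (fun j => parSymY (f j).toKIdx)
      (fun j => GAQY (f j).toKIdx (qKnitOfRecord N θ (f j).toKIdx) (qsKnitOfRecord N θ (f j).toKIdx) (parKnitY (f j).toKIdx) (GpY (f j).toKIdx (parKnitY (f j).toKIdx)))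
      (fun j => parBY (f j).toKIdx)
      (fun j => C37KY (specialUnitaryUnits (Fin N)) (f j) (ιB j)
        (fun α₀ U => (bg9YC (Matrix (Fin N) (Fin N) ℂ) (specialUnitaryUnits (Fin N)) (extraYPb (Matrix (Fin N) (Fin N) ℂ) (specialUnitaryUnits (Fin N))) (f j)).Reg335 c35Y α₀ U)
        (cqY θ.d₆) CqK MK aInv (ϱ' * (((θ.ℓ₆ + 1 : ℕ) : ℝ)) ^ 3 / 3))
      C38 (CinvY (extraYPb (Matrix (Fin N) (Fin N) ℂ) (specialUnitaryUnits (Fin N))) f (specialUnitaryUnits (Fin N)) (fun j => parKnitY (f j).toKIdx)) := by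
  obtain ⟨M₁, a₁, hM₁, ha₁, hΔ⟩ := symm_posDefTr_deltaAQY_knitRecord_at_scMember (N := N) θ Mstar
  refine ⟨a₁, ha₁, fun aInv haInv haIΔ haIK h32 h33 => ?_⟩
  have habs : rLB θ.d₆ θ.ℓ₆ ≤ |rLB θ.d₆ θ.ℓ₆| := le_abs_self _
  have habs0 : 0 ≤ |rLB θ.d₆ θ.ℓ₆| := abs_nonneg _
  have hd0 : (0 : ℝ) ≤ 2 * ((θ.d₆ : ℝ) + 1) := by positivity
  -- the guarded knit Thm 3.11 unit at the family's (section-carrying) members, on the coded class of record projected onto print's class (3.35)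
  have hunitA : ∀ j (α₀ : ℝ) (U : CfgY (Matrix (Fin N) (Fin N) ℂ) (f j).toKIdx), M₁ + |rLB θ.d₆ θ.ℓ₆| + 2 * ((θ.d₆ : ℝ) + 1) + 2 ≤ (geo9Y (f j)).M →
      0 < α₀ → (geo9Y (f j)).M * α₀ ≤ aInv →
      (bg9YC (Matrix (Fin N) (Fin N) ℂ) (specialUnitaryUnits (Fin N)) (extraYPb (Matrix (Fin N) (Fin N) ℂ) (specialUnitaryUnits (Fin N))) (f j)).Reg335 c35Y α₀ U →
      IsUnit (deltaAQY (f j).toKIdx (qKnitOfRecord N θ (f j).toKIdx) (qsKnitOfRecord N θ (f j).toKIdx) (parKnitY (f j).toKIdx)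
        (GpY (f j).toKIdx (parKnitY (f j).toKIdx)) U) :=
    fun j α₀ U hM hα ha hU => isUnit_of_posDefTr
      (hΔ (f j) (fun s => ⟨ιB j s, hι j s⟩) (by linarith) α₀ hα (ha.trans haIΔ) U ⟨⟨hU.1.1, hU.1.2.2⟩, hU.2⟩).2
  exact sectBStepUPar_knitRecordN θ Mstar f b ιB C38 CqK MK aInv hι (coordBound39 b) (coordBound39_pos b).le (abs_repr_le b)
    (coordBound39_mul_sum_norm_pos b) (sqrt_card_mul_coordBound39_mul_sum_norm_pos b) hCqK
    (M₁ + |rLB θ.d₆ θ.ℓ₆| + 2 * ((θ.d₆ : ℝ) + 1) + 2) 1 (by linarith) haInv one_pos hαK hαQ hα8 hα4N hαπN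
    (fun j a h0 ha => hKplK (f j).toKIdx a h0 (ha.trans haIK)) hϱ' hϱ hsmall' hc₃' hϱ'1 hE hdX hsmall hc₃ hunitA (by linarith)
    (nbrCountY θ.d₆ θ.ℓ₆ θ.hd' θ.hL' θ.b₀ θ.b₁ (2 * ((θ.d₆ : ℝ) + 1))) (fun j y' => hnbr_of_le hM₀K (f j) y') (by linarith) h32 h33

end Record

end Summit.QuantumFields.YangMills.BalabanUVNodes.N06SectBStepUParKnitRecordNB

end
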